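import Summits.AnomalousDissipation.AnomalousDissipation.Theses.SolenoidalFractalHomogenisation
import Summits.AnomalousDissipation.AnomalousDissipation.Theorems.QuasiStaticSolenoidalCellTensorQ.Negative.FloorAll
import Summits.AnomalousDissipation.AnomalousDissipation.Theorems.QuasiStaticSolenoidalCellTensorQ.Negative.Reduction
import Summits.AnomalousDissipation.AnomalousDissipation.Theorems.SolenoidalFractalHomogenisationLagrangianStepDefs
import Summits.AnomalousDissipation.AnomalousDissipation.Theorems.SolenoidalFractalHomogenisationProjectedRenormalisationStepDefs
import HarnessLib

/-!
# K1 `ProjectedRenormalisationStep` (stmt-AnomalousDissipation-19071) holds — VACUOUSLY — and its registered stub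
# `stub_cascade` by name

Theorems file of route `SolenoidalFractalHomogenisation` closing the item `stmt-AnomalousDissipation-19071`
(`Summit.AnomalousDissipation.AnomalousDissipation.Theses.SolenoidalFractalHomogenisation.ProjectedRenormalisationStep`, the
rev ≤ 4 crux K1, an ASIDE since rev 5).  HONEST LABEL: the item is TRUE FOR THE WRONG REASON.  Its third hypothesis — the
NOMINAL quasi-static gain family `∀ c < c₀, ∃ ν₀ K, WordGainAtRate W c ν₀ K 1` of an isotropic word with nominal Taylor
constant `c₀` — is contradictory for EVERY lattice word (`LatticeWord.ramp_pos`: every word is ramped, and a ramped word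
realises only `(1 − 4ρ/3)c₀ < c₀`, cell finding F12): the general-word realised energy FLOOR `Negative.floorAll` (this seat)
fed to `Negative.not_quasiStatic_of_floorAll` (prover leafhand-3, p802504) refutes the route's K2Q
`QuasiStaticSolenoidalCellTensorQ = ∃ W, (isotropic ∧ nominal family)`, i.e. proves `∀ W, ¬(nominal family)`
(`not_nominalGainFamily`).  Hence every `∀ W, … → (nominal family) → …` statement holds ex falso: the registered stub
`stub_cascade` (skeleton `e2b567d2f478eabc`, text verbatim) and the item itself (`projectedRenormalisationStep_proof`).
The refuters' notes on the item (critic-2 g9, refuter1 g23/g24: «vacuous-modulo-F12 … proving even that needs the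
general-word energy floor the tree does not have») are hereby discharged: the floor is in the tree.  The CONTENT of K1
lives on in the superseding items (K1R/K1L/K1L_D, realised constant); nothing here bears on them, on the route's Target,
or on anomalous dissipation.  Rung F-D1.A0 unchanged.  Prover seat `leafhand-ad-solenoidalfractalh-5` g0.
-/

set_option linter.dupNamespace false

noncomputable section

namespace Summit.AnomalousDissipation.AnomalousDissipation.Theorems.SolenoidalFractalHomogenisation.ProjectedRenormalisationStep

open Literature.Analysis Literature.Analysis.FluidPDE Literature.Analysis.FunctionSpaces
open MeasureTheory Set Filter Function
open scoped ENNReal NNReal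
open Summit.AnomalousDissipation.AnomalousDissipation.Theorems.SolenoidalFractalHomogenisation.LagrangianStep (IsDatum InClass)
open Summit.AnomalousDissipation.AnomalousDissipation.Theorems.QuasiStaticSolenoidalCellTensorQ.Negative
  (floorAll not_quasiStatic_of_floorAll)

variable {k : ℕ}

/-- **The route's K2Q `QuasiStaticSolenoidalCellTensorQ` is false**: no isotropic lattice word realises every nominal gain
`c < c₀` (general-word realised floor `floorAll` + the crossing-time reduction `not_quasiStatic_of_floorAll`). -/
theorem not_quasiStaticSolenoidalCellTensorQ :
    ¬ Summit.AnomalousDissipation.AnomalousDissipation.Theses.SolenoidalFractalHomogenisation.QuasiStaticSolenoidalCellTensorQ :=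
  not_quasiStatic_of_floorAll floorAll

/-- **The nominal gain family is contradictory for every isotropic lattice word** (`c₀ > 0`): the per-word form of
`not_quasiStaticSolenoidalCellTensorQ`. -/
theorem not_nominalGainFamily (W : LatticeShear.LatticeWord k) {c₀ : ℝ} (hc₀ : 0 < c₀)
    (hW : LatticeShear.IsotropicWordGain W c₀) :
    ¬ (∀ c, 0 < c → c < c₀ → ∃ ν₀ > (0:ℝ), ∃ K > (0:ℝ), LatticeShear.WordGainAtRate W c ν₀ K 1) :=
  fun H => not_quasiStaticSolenoidalCellTensorQ ⟨k, W, c₀, hc₀, hW, H⟩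

/-- **Registered stub `stub_cascade` of the K1 birth skeleton (text verbatim) — VACUOUSLY**: its third hypothesis is the
nominal gain family, refuted for every word by `not_nominalGainFamily`. -/
theorem stub_cascade : ∀ k (W : LatticeShear.LatticeWord k) (c₀ : ℝ), 0 < c₀ → LatticeShear.IsotropicWordGain W c₀ →
    (∀ c, 0 < c → c < c₀ → ∃ ν₀ > (0:ℝ), ∃ K > (0:ℝ), LatticeShear.WordGainAtRate W c ν₀ K 1) →
    ∃ ν₀ > (0:ℝ), ∃ K > (0:ℝ), ∃ Λ₀ : ℕ, ∀ D : LatticeShear.FractalCarrierData k, D.design = W → D.gain = c₀ → D.nu0 = ν₀ →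
      D.K = K → D.Permissible → D.Regular → (∀ m, Λ₀ * D.N m ≤ D.N (m + 1)) → ∀ R : ℝ≥0, ∃ mstar : ℕ, ∃ θ : ℝ, 0 < θ ∧
      ∃ j₁ : ℕ, ∀ j ≥ j₁, ∀ (w₀ : UnitAddTorus (Fin 3) → EuclideanSpace ℝ (Fin 3))
        (v u : ℝ → UnitAddTorus (Fin 3) → EuclideanSpace ℝ (Fin 3)), IsDatum w₀ → InClass R w₀ → TruncSol D j w₀ v →
        TruncSol D mstar w₀ u → ENNReal.ofReal θ * Diss D mstar u ≤ Diss D j v :=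
  fun _ W _ hc₀ hW H => absurd H (not_nominalGainFamily W hc₀ hW)

/-- **Item `stmt-AnomalousDissipation-19071`, the route decl `ProjectedRenormalisationStep`, VACUOUSLY** (see the module
docstring: its nominal-gain hypothesis is contradictory for every lattice word). -/
theorem projectedRenormalisationStep_proof :
    Summit.AnomalousDissipation.AnomalousDissipation.Theses.SolenoidalFractalHomogenisation.ProjectedRenormalisationStep :=
  fun _ W _ hc₀ hW H => absurd H (not_nominalGainFamily W hc₀ hW)

end Summit.AnomalousDissipation.AnomalousDissipation.Theorems.SolenoidalFractalHomogenisation.ProjectedRenormalisationStep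

end
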